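import Mathlib
import HarnessLib

/-!
# The quadratic HOPF–LAX infimum-convolution `Q_s g(z) = inf_w [g(w) + d(z,w)²/(2s)]` on a compact metric space: minimisers, the farthest-
# minimiser distance `D_s⁺(z)`, its upper semicontinuity, and the two one-sided inequalities behind the Hamilton–Jacobi equation
# `∂_s Q_s g + ½|∇Q_s g|² ≤ 0`:  `Q_{s'} g − Q_s g ≤ −(s'−s)·D_s⁺²/(2ss')`  and  `Q_s g(z'') − Q_s g(z') ≤ d(z',z'')·(2D_s⁺(z') + d(z',z''))/(2s)`

Seat `ym-line-csu-p1` (g42), route `ColdStartUniversality` of `Summits/QuantumFields/YangMills`, helper file G62 (`--supports stmt-QuantumFields-24809`).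
GENERIC metric-space lemmas (any compact metric space `X`; later instantiated with `X = SU(2)^E` and Shen–Zhu–Zhu's product Riemannian metric
`ρ_L`), written WITHOUT definitions: the Hopf–Lax value is the term `⨅ w, (g w + dist z w ^ 2 / (2 * s))` and the farthest-minimiser distance is
`sSup ((dist z) '' {minimisers})`.  They are the metric half of Kuwada's duality `|∇P_t f|² ≤ e^{−2Kt} P_t|∇f|² ⇒ W₂-contraction`
(Bakry–Gentil–Ledoux Prop. 9.7.1 / Thm. 9.7.2), carried out for the `SU(2)` lattice Langevin dynamics in the sequel files.

* §1 `hopfLax_exists_isMinOn`, `hopfLax_bddBelow`, `hopfLax_le`, `hopfLax_eq_of_isMinOn`, `hopfLax_le_self`, `self_sub_le_hopfLax`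
  (`g − L_g² s/2 ≤ Q_s g ≤ g` for `L_g`-Lipschitz `g`);
* §2 `hopfLax_exists_farthest`, `dist_le_hopfLaxFar`, `hopfLaxFar_nonneg`, `hopfLaxFar_le` (`D_s⁺ ≤ 2 s L_g`);
* §3 ★★ `hopfLaxFar_upperSemicontinuous` — `z ↦ D_s⁺(z)` is upper semicontinuous (compactness);
* §4 ★★ `hopfLax_time_le` (`Q_{s'} g(z) ≤ Q_s g(z) − (s'−s)·D_s⁺(z)²/(2ss')`, `0 < s ≤ s'`) and ★★ `hopfLax_slope_le`
  (`Q_s g(z'') − Q_s g(z') ≤ d(z',z'')·(2D_s⁺(z') + d(z',z''))/(2s)`); `hopfLax_lipschitz` (`Q_s g` is `3L_g`-Lipschitz);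
* §5 ★ `upperSemicontinuous_sSup_closedBall`, `le_sSup_closedBall`, `tendsto_sSup_closedBall` — suprema of an u.s.c. function over closed balls;
* §6 `half_le_hopfLax_one`, `exists_lipschitz_potential` — the Kantorovich side: `φ ⊕ ψ ≤ d²` ⇒ `φ/2 ≤ Q₁(−ψ/2)`, and `ψ` may be replaced by a
  Lipschitz `c`-transform.

THEOREMS ONLY, no definition, no sorry.  HONEST FRAMING: pure metric geometry; nothing here is specific to Yang–Mills; no crux, rung or summit
statement is proved; the Yang–Mills mass gap is NOT proved.
-/

set_option autoImplicit false

noncomputable section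

namespace Summit.QuantumFields.YangMills.Theorems.ColdStartUniversality

open Filter Topology Set Metric

variable {X : Type*} [MetricSpace X] [CompactSpace X]

/-! ## §1. Minimisers and the value of the Hopf–Lax infimum -/

/-- A minimiser of `w ↦ g(w) + d(z,w)²/(2s)` exists (continuity on a compact space). [cite: BakryGentilLedoux2014, Prop 9.4.1 / (9.4.4)] -/
theorem hopfLax_exists_isMinOn {g : X → ℝ} (hg : Continuous g) (s : ℝ) (z : X) :
    ∃ w : X, ∀ w' : X, g w + dist z w ^ 2 / (2 * s) ≤ g w' + dist z w' ^ 2 / (2 * s) := by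
  have hc : Continuous fun w => g w + dist z w ^ 2 / (2 * s) := by fun_prop
  obtain ⟨w, -, hw⟩ := isCompact_univ.exists_isMinOn ⟨z, Set.mem_univ z⟩ hc.continuousOn
  exact ⟨w, fun w' => hw (Set.mem_univ w')⟩

/-- The Hopf–Lax objective is bounded below. [cite: BakryGentilLedoux2014, Prop 9.4.1 / (9.4.4)] -/
theorem hopfLax_bddBelow {g : X → ℝ} (hg : Continuous g) (s : ℝ) (z : X) :
    BddBelow (Set.range fun w => g w + dist z w ^ 2 / (2 * s)) := by
  obtain ⟨w, hw⟩ := hopfLax_exists_isMinOn hg s z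
  exact ⟨g w + dist z w ^ 2 / (2 * s), by rintro _ ⟨w', rfl⟩; exact hw w'⟩

/-- `Q_s g(z) ≤ g(w') + d(z,w')²/(2s)` for every competitor `w'`. [cite: BakryGentilLedoux2014, Prop 9.4.1 / (9.4.4)] -/
theorem hopfLax_le {g : X → ℝ} (hg : Continuous g) (s : ℝ) (z w' : X) :
    (⨅ w, (g w + dist z w ^ 2 / (2 * s))) ≤ g w' + dist z w' ^ 2 / (2 * s) :=
  ciInf_le (hopfLax_bddBelow hg s z) w'

/-- At a minimiser the infimum is attained: `Q_s g(z) = g(w) + d(z,w)²/(2s)`. [cite: BakryGentilLedoux2014, Prop 9.4.1 / (9.4.4)] -/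
theorem hopfLax_eq_of_isMinOn {g : X → ℝ} (hg : Continuous g) {s : ℝ} {z w : X}
    (hw : ∀ w' : X, g w + dist z w ^ 2 / (2 * s) ≤ g w' + dist z w' ^ 2 / (2 * s)) :
    (⨅ w', (g w' + dist z w' ^ 2 / (2 * s))) = g w + dist z w ^ 2 / (2 * s) := by
  haveI : Nonempty X := ⟨z⟩
  exact le_antisymm (hopfLax_le hg s z w) (le_ciInf hw)

/-- `Q_s g ≤ g` (competitor `w' = z`). [cite: BakryGentilLedoux2014, Prop 9.4.1 / (9.4.4)] -/
theorem hopfLax_le_self {g : X → ℝ} (hg : Continuous g) (s : ℝ) (z : X) :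
    (⨅ w, (g w + dist z w ^ 2 / (2 * s))) ≤ g z := by
  have h := hopfLax_le hg s z z
  simpa using h

omit [CompactSpace X] in
/-- For `L_g`-Lipschitz `g` and `s > 0`: `g(z) − L_g² s/2 ≤ Q_s g(z)` (since `L_g d ≤ (L_g² s² + d²)/(2s)`). [cite: BakryGentilLedoux2014, Prop 9.4.1 / (9.4.4)] -/
theorem self_sub_le_hopfLax {g : X → ℝ} {Lg : ℝ} (hlip : ∀ z w, |g z - g w| ≤ Lg * dist z w) {s : ℝ} (hs : 0 < s) (z : X) :
    g z - Lg ^ 2 * s / 2 ≤ ⨅ w, (g w + dist z w ^ 2 / (2 * s)) := by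
  haveI : Nonempty X := ⟨z⟩
  refine le_ciInf fun w => ?_
  have h1 : g z - g w ≤ Lg * dist z w := (le_abs_self _).trans (hlip z w)
  have h2 : Lg * dist z w ≤ Lg ^ 2 * s / 2 + dist z w ^ 2 / (2 * s) := by
    have hkey : Lg ^ 2 * s / 2 + dist z w ^ 2 / (2 * s) - Lg * dist z w = (Lg * s - dist z w) ^ 2 / (2 * s) := by
      field_simp
      ring
    have : 0 ≤ (Lg * s - dist z w) ^ 2 / (2 * s) := div_nonneg (sq_nonneg _) (by linarith)
    linarith
  linarith

/-! ## §2. The farthest-minimiser distance `D_s⁺(z)` -/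

/-- The set of minimisers is compact and nonempty, so a FARTHEST minimiser exists:
`∃ w ∈ argmin, d(z,w) = D_s⁺(z) := sup {d(z,w') : w' ∈ argmin}`. [cite: BakryGentilLedoux2014, Prop 9.4.1 / (9.4.4)] -/
theorem hopfLax_exists_farthest {g : X → ℝ} (hg : Continuous g) (s : ℝ) (z : X) :
    ∃ w : X, (∀ w' : X, g w + dist z w ^ 2 / (2 * s) ≤ g w' + dist z w' ^ 2 / (2 * s)) ∧
      dist z w = sSup ((fun w => dist z w) '' {w | ∀ w' : X, g w + dist z w ^ 2 / (2 * s) ≤ g w' + dist z w' ^ 2 / (2 * s)}) := by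
  set A : Set X := {w | ∀ w' : X, g w + dist z w ^ 2 / (2 * s) ≤ g w' + dist z w' ^ 2 / (2 * s)} with hA
  have hne : A.Nonempty := by obtain ⟨w, hw⟩ := hopfLax_exists_isMinOn hg s z; exact ⟨w, hw⟩
  have hclosed : IsClosed A := by
    have : A = ⋂ w' : X, {w | g w + dist z w ^ 2 / (2 * s) ≤ g w' + dist z w' ^ 2 / (2 * s)} := by
      ext w; simp [hA]
    rw [this]
    exact isClosed_iInter fun w' => isClosed_le (by fun_prop) (by fun_prop)
  have hcpt : IsCompact A := hclosed.isCompact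
  obtain ⟨w, hwA, hmax⟩ := hcpt.exists_isMaxOn hne (continuous_const.dist continuous_id).continuousOn
  refine ⟨w, hwA, ?_⟩
  symm
  refine IsGreatest.csSup_eq ⟨⟨w, hwA, rfl⟩, ?_⟩
  rintro _ ⟨w', hw', rfl⟩
  exact hmax hw'

/-- Every minimiser is within `D_s⁺(z)` of `z`. [cite: BakryGentilLedoux2014, Prop 9.4.1 / (9.4.4)] -/
theorem dist_le_hopfLaxFar {g : X → ℝ} (s : ℝ) (z : X) {w : X}
    (hw : ∀ w' : X, g w + dist z w ^ 2 / (2 * s) ≤ g w' + dist z w' ^ 2 / (2 * s)) :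
    dist z w ≤ sSup ((fun w => dist z w) '' {w | ∀ w' : X, g w + dist z w ^ 2 / (2 * s) ≤ g w' + dist z w' ^ 2 / (2 * s)}) := by
  refine le_csSup ?_ ⟨w, hw, rfl⟩
  obtain ⟨C, hC⟩ := (isBounded_iff_subset_closedBall z).1 (isCompact_univ (X := X)).isBounded
  refine ⟨C, ?_⟩
  rintro _ ⟨w', -, rfl⟩
  have h := hC (Set.mem_univ w')
  rw [mem_closedBall, dist_comm] at h
  exact h

/-- `0 ≤ D_s⁺(z)`. [cite: BakryGentilLedoux2014, Prop 9.4.1 / (9.4.4)] -/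
theorem hopfLaxFar_nonneg {g : X → ℝ} (hg : Continuous g) (s : ℝ) (z : X) :
    0 ≤ sSup ((fun w => dist z w) '' {w | ∀ w' : X, g w + dist z w ^ 2 / (2 * s) ≤ g w' + dist z w' ^ 2 / (2 * s)}) := by
  obtain ⟨w, hw, heq⟩ := hopfLax_exists_farthest hg s z
  rw [← heq]; exact dist_nonneg

/-- **`D_s⁺(z) ≤ 2 s L_g`** for `L_g`-Lipschitz `g` and `s > 0`: a minimiser `w` satisfies `d²/(2s) ≤ g(z) − g(w) ≤ L_g d`.
[cite: BakryGentilLedoux2014, Prop 9.4.1 / (9.4.4)] -/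
theorem hopfLaxFar_le {g : X → ℝ} (hg : Continuous g) {Lg : ℝ} (hLg : 0 ≤ Lg) (hlip : ∀ z w, |g z - g w| ≤ Lg * dist z w)
    {s : ℝ} (hs : 0 < s) (z : X) :
    sSup ((fun w => dist z w) '' {w | ∀ w' : X, g w + dist z w ^ 2 / (2 * s) ≤ g w' + dist z w' ^ 2 / (2 * s)}) ≤ 2 * s * Lg := by
  obtain ⟨w, hw, heq⟩ := hopfLax_exists_farthest hg s z
  rw [← heq]
  have h1 := hw z
  simp only [dist_self, ne_eq, OfNat.ofNat_ne_zero, not_false_eq_true, zero_pow, zero_div, add_zero] at h1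
  have h2 : g z - g w ≤ Lg * dist z w := (le_abs_self _).trans (hlip z w)
  have h3 : dist z w ^ 2 / (2 * s) ≤ Lg * dist z w := by linarith
  by_cases hd : dist z w = 0
  · rw [hd]; positivity
  · have hdpos : 0 < dist z w := lt_of_le_of_ne dist_nonneg (Ne.symm hd)
    rw [div_le_iff₀ (by linarith), sq] at h3
    nlinarith

/-! ## §3. Upper semicontinuity of the farthest-minimiser distance -/

/-- ★★ **`z ↦ D_s⁺(z)` is upper semicontinuous.**  If `z_n → z` with `D_s⁺(z_n) ≥ y`, farthest minimisers `w_n` subconverge to a minimiser `w`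
for `z` with `d(z,w) ≥ y` (the minimiser relation is closed in `X × X`). [cite: BakryGentilLedoux2014, Prop 9.4.1 / (9.4.4)] -/
theorem hopfLaxFar_upperSemicontinuous {g : X → ℝ} (hg : Continuous g) (s : ℝ) :
    UpperSemicontinuous fun z : X =>
      sSup ((fun w => dist z w) '' {w | ∀ w' : X, g w + dist z w ^ 2 / (2 * s) ≤ g w' + dist z w' ^ 2 / (2 * s)}) := by
  rw [upperSemicontinuous_iff_isClosed_preimage]
  intro y
  refine IsSeqClosed.isClosed fun zs z₀ hzs hlim => ?_
  -- farthest minimisers along the sequence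
  have hfar : ∀ n, ∃ w : X, (∀ w' : X, g w + dist (zs n) w ^ 2 / (2 * s) ≤ g w' + dist (zs n) w' ^ 2 / (2 * s)) ∧
      dist (zs n) w = sSup ((fun w => dist (zs n) w) '' {w | ∀ w' : X, g w + dist (zs n) w ^ 2 / (2 * s) ≤ g w' + dist (zs n) w' ^ 2 / (2 * s)}) :=
    fun n => hopfLax_exists_farthest hg s (zs n)
  choose ws hws hfar using hfar
  obtain ⟨w₀, φ, hφ, hwlim⟩ := CompactSpace.tendsto_subseq ws
  have hzlim : Tendsto (zs ∘ φ) atTop (𝓝 z₀) := hlim.comp hφ.tendsto_atTop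
  have hpair : Tendsto (fun n => (zs (φ n), ws (φ n))) atTop (𝓝 (z₀, w₀)) := hzlim.prodMk_nhds hwlim
  -- the minimiser relation is closed
  have hrel : IsClosed {p : X × X | ∀ w' : X, g p.2 + dist p.1 p.2 ^ 2 / (2 * s) ≤ g w' + dist p.1 w' ^ 2 / (2 * s)} := by
    have : {p : X × X | ∀ w' : X, g p.2 + dist p.1 p.2 ^ 2 / (2 * s) ≤ g w' + dist p.1 w' ^ 2 / (2 * s)} =
        ⋂ w' : X, {p : X × X | g p.2 + dist p.1 p.2 ^ 2 / (2 * s) ≤ g w' + dist p.1 w' ^ 2 / (2 * s)} := by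
      ext p; simp
    rw [this]
    exact isClosed_iInter fun w' => isClosed_le (by fun_prop) (by fun_prop)
  have hw₀ : ∀ w' : X, g w₀ + dist z₀ w₀ ^ 2 / (2 * s) ≤ g w' + dist z₀ w' ^ 2 / (2 * s) :=
    hrel.mem_of_tendsto hpair (Eventually.of_forall fun n => hws (φ n))
  -- `d(z₀, w₀) ≥ y`
  have hdist : Tendsto (fun n => dist (zs (φ n)) (ws (φ n))) atTop (𝓝 (dist z₀ w₀)) := hzlim.dist hwlim
  have hge : y ≤ dist z₀ w₀ := by
    refine ge_of_tendsto hdist (Eventually.of_forall fun n => ?_)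
    have h := hzs (φ n)
    simp only [Set.mem_preimage, Set.mem_Ici] at h
    rw [hfar (φ n)]
    exact h
  simp only [Set.mem_preimage, Set.mem_Ici]
  exact hge.trans (dist_le_hopfLaxFar s z₀ hw₀)

/-! ## §4. The Hamilton–Jacobi inequalities in difference form -/

/-- ★★ **Time monotonicity**: for `0 < s ≤ s'`,  `Q_{s'} g(z) ≤ Q_s g(z) − (s' − s)·D_s⁺(z)²/(2ss')` (use the farthest `s`-minimiser as a
competitor at time `s'`). [cite: BakryGentilLedoux2014, Prop 9.4.1 / (9.4.4)] -/
theorem hopfLax_time_le {g : X → ℝ} (hg : Continuous g) {s s' : ℝ} (hs : 0 < s) (hss' : s ≤ s') (z : X) :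
    (⨅ w, (g w + dist z w ^ 2 / (2 * s'))) ≤ (⨅ w, (g w + dist z w ^ 2 / (2 * s))) -
      (s' - s) / (2 * s * s') * (sSup ((fun w => dist z w) '' {w | ∀ w' : X, g w + dist z w ^ 2 / (2 * s) ≤ g w' + dist z w' ^ 2 / (2 * s)})) ^ 2 := by
  obtain ⟨w, hw, heq⟩ := hopfLax_exists_farthest hg s z
  rw [← heq, hopfLax_eq_of_isMinOn hg hw]
  have h1 := hopfLax_le hg s' z w
  have hs' : 0 < s' := lt_of_lt_of_le hs hss'
  have halg : g w + dist z w ^ 2 / (2 * s') = g w + dist z w ^ 2 / (2 * s) - (s' - s) / (2 * s * s') * dist z w ^ 2 := by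
    field_simp
    ring
  linarith

/-- ★★ **Slope bound**: for `s > 0` and all `z', z''`,  `Q_s g(z'') − Q_s g(z') ≤ d(z',z'')·(2 D_s⁺(z') + d(z',z''))/(2s)` (use an
`s`-minimiser `w'` for `z'` as a competitor for `z''`, `d(z'',w')² − d(z',w')² ≤ d(z',z'')(2d(z',w') + d(z',z''))`).
[cite: BakryGentilLedoux2014, Prop 9.4.1 / (9.4.4)] -/
theorem hopfLax_slope_le {g : X → ℝ} (hg : Continuous g) {s : ℝ} (hs : 0 < s) (z' z'' : X) :
    (⨅ w, (g w + dist z'' w ^ 2 / (2 * s))) - (⨅ w, (g w + dist z' w ^ 2 / (2 * s))) ≤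
      dist z' z'' * (2 * sSup ((fun w => dist z' w) '' {w | ∀ w' : X, g w + dist z' w ^ 2 / (2 * s) ≤ g w' + dist z' w' ^ 2 / (2 * s)}) +
        dist z' z'') / (2 * s) := by
  obtain ⟨w, hw, heq⟩ := hopfLax_exists_farthest hg s z'
  rw [← heq, hopfLax_eq_of_isMinOn hg hw]
  have h1 := hopfLax_le hg s z'' w
  have htri : dist z'' w ≤ dist z' z'' + dist z' w := by
    have := dist_triangle z'' z' w; rw [dist_comm z'' z'] at this; exact this
  have hsq : dist z'' w ^ 2 ≤ (dist z' z'' + dist z' w) ^ 2 := pow_le_pow_left₀ dist_nonneg htri 2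
  have h2 : dist z'' w ^ 2 / (2 * s) - dist z' w ^ 2 / (2 * s) ≤ dist z' z'' * (2 * dist z' w + dist z' z'') / (2 * s) := by
    rw [← sub_div]
    refine div_le_div_of_nonneg_right ?_ (by linarith)
    nlinarith
  linarith

/-- **`Q_s g` is `3L_g`-Lipschitz** for `L_g`-Lipschitz `g` and `s > 0` (slope bound with `D_s⁺ ≤ 2sL_g` for near pairs, `Q_s g ≤ g ≤ Q_s g + L_g²s/2`
for far pairs). [cite: BakryGentilLedoux2014, Prop 9.4.1 / (9.4.4)] -/
theorem hopfLax_lipschitz {g : X → ℝ} (hg : Continuous g) {Lg : ℝ} (hLg : 0 ≤ Lg) (hlip : ∀ z w, |g z - g w| ≤ Lg * dist z w)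
    {s : ℝ} (hs : 0 < s) (z' z'' : X) :
    |(⨅ w, (g w + dist z'' w ^ 2 / (2 * s))) - (⨅ w, (g w + dist z' w ^ 2 / (2 * s)))| ≤ 3 * Lg * dist z' z'' := by
  -- one-sided bound, then symmetry
  have key : ∀ a b : X, (⨅ w, (g w + dist b w ^ 2 / (2 * s))) - (⨅ w, (g w + dist a w ^ 2 / (2 * s))) ≤ 3 * Lg * dist a b := by
    intro a b
    by_cases hfar : dist a b ≤ 2 * s * Lg
    · have h := hopfLax_slope_le hg hs a b
      have hD := hopfLaxFar_le hg hLg hlip hs a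
      have hD0 := hopfLaxFar_nonneg hg s a
      calc _ ≤ dist a b * (2 * sSup ((fun w => dist a w) '' {w | ∀ w' : X, g w + dist a w ^ 2 / (2 * s) ≤ g w' + dist a w' ^ 2 / (2 * s)}) +
            dist a b) / (2 * s) := h
        _ ≤ dist a b * (2 * (2 * s * Lg) + 2 * s * Lg) / (2 * s) := by gcongr
        _ = 3 * Lg * dist a b := by field_simp; ring
    · push Not at hfar
      have h1 : (⨅ w, (g w + dist b w ^ 2 / (2 * s))) ≤ g b := hopfLax_le_self hg s b
      have h2 : g a - Lg ^ 2 * s / 2 ≤ ⨅ w, (g w + dist a w ^ 2 / (2 * s)) := self_sub_le_hopfLax hlip hs a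
      have h3 : g b - g a ≤ Lg * dist a b := by
        have := hlip b a; rw [dist_comm] at this; exact (le_abs_self _).trans this
      have h4 : Lg ^ 2 * s / 2 ≤ Lg * dist a b := by nlinarith
      nlinarith [dist_nonneg (x := a) (y := b)]
  rw [abs_le]
  constructor
  · have := key z'' z'; rw [dist_comm] at this; linarith
  · exact key z' z''

/-- `Q_s g` is continuous (it is Lipschitz). [cite: BakryGentilLedoux2014, Prop 9.4.1 / (9.4.4)] -/
theorem hopfLax_continuous {g : X → ℝ} (hg : Continuous g) {Lg : ℝ} (hLg : 0 ≤ Lg) (hlip : ∀ z w, |g z - g w| ≤ Lg * dist z w)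
    {s : ℝ} (hs : 0 < s) : Continuous fun z : X => ⨅ w, (g w + dist z w ^ 2 / (2 * s)) := by
  refine continuous_iff_continuousAt.2 fun z => Metric.continuousAt_iff.2 fun ε hε => ⟨ε / (3 * Lg + 1), by positivity, fun z' hz' => ?_⟩
  rw [Real.dist_eq]
  calc _ ≤ 3 * Lg * dist z z' := hopfLax_lipschitz hg hLg hlip hs z z'
    _ ≤ (3 * Lg + 1) * dist z' z := by rw [dist_comm]; nlinarith [dist_nonneg (x := z') (y := z)]
    _ < (3 * Lg + 1) * (ε / (3 * Lg + 1)) := mul_lt_mul_of_pos_left hz' (by positivity)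
    _ = ε := by field_simp

/-! ## §5. Suprema of an upper semicontinuous function over closed balls -/

/-- `f(z) ≤ sup_{B̄(w,R)} f` for `z ∈ B̄(w,R)` (`f` u.s.c., hence bounded above on the compact ball). [folklore] -/
theorem le_sSup_closedBall {f : X → ℝ} (hf : UpperSemicontinuous f) (w : X) (R : ℝ) {z : X} (hz : z ∈ closedBall w R) :
    f z ≤ sSup (f '' closedBall w R) :=
  le_csSup ((hf.upperSemicontinuousOn _).bddAbove_of_isCompact (isCompact_closedBall w R)) ⟨z, hz, rfl⟩

/-- The supremum over a closed ball of radius `R ≥ 0` is attained. [folklore] -/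
theorem exists_eq_sSup_closedBall {f : X → ℝ} (hf : UpperSemicontinuous f) (w : X) {R : ℝ} (hR : 0 ≤ R) :
    ∃ v ∈ closedBall w R, f v = sSup (f '' closedBall w R) := by
  obtain ⟨v, hv, hmax⟩ := (hf.upperSemicontinuousOn (closedBall w R)).exists_isMaxOn ⟨w, mem_closedBall_self hR⟩ (isCompact_closedBall w R)
  refine ⟨v, hv, ?_⟩
  symm
  exact IsGreatest.csSup_eq ⟨⟨v, hv, rfl⟩, by rintro _ ⟨v', hv', rfl⟩; exact hmax hv'⟩

/-- ★ **`w ↦ sup_{B̄(w,R)} f` is upper semicontinuous** for u.s.c. `f` and `R ≥ 0` (maximisers over the balls subconverge, and `{f ≥ y}` is closed).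
[folklore] -/
theorem upperSemicontinuous_sSup_closedBall {f : X → ℝ} (hf : UpperSemicontinuous f) {R : ℝ} (hR : 0 ≤ R) :
    UpperSemicontinuous fun w : X => sSup (f '' closedBall w R) := by
  rw [upperSemicontinuous_iff_isClosed_preimage]
  intro y
  refine IsSeqClosed.isClosed fun ws w₀ hws hlim => ?_
  have hmax : ∀ n, ∃ v ∈ closedBall (ws n) R, f v = sSup (f '' closedBall (ws n) R) := fun n => exists_eq_sSup_closedBall hf (ws n) hR
  choose vs hvs hveq using hmax
  obtain ⟨v₀, φ, hφ, hvlim⟩ := CompactSpace.tendsto_subseq vs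
  have hwlim : Tendsto (ws ∘ φ) atTop (𝓝 w₀) := hlim.comp hφ.tendsto_atTop
  -- `v₀ ∈ B̄(w₀, R)`
  have hdist : Tendsto (fun n => dist (vs (φ n)) (ws (φ n))) atTop (𝓝 (dist v₀ w₀)) := hvlim.dist hwlim
  have hv₀ : v₀ ∈ closedBall w₀ R := by
    rw [mem_closedBall]
    exact le_of_tendsto hdist (Eventually.of_forall fun n => mem_closedBall.1 (hvs (φ n)))
  -- `f v₀ ≥ y`
  have hclosed : IsClosed (f ⁻¹' Set.Ici y) := (upperSemicontinuous_iff_isClosed_preimage.1 hf) y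
  have hfv₀ : y ≤ f v₀ := by
    have h := hclosed.mem_of_tendsto hvlim (Eventually.of_forall fun n => ?_)
    · simpa using h
    · have h1 := hws (φ n)
      simp only [Set.mem_preimage, Set.mem_Ici] at h1 ⊢
      show y ≤ f (vs (φ n))
      rw [hveq (φ n)]; exact h1
  simp only [Set.mem_preimage, Set.mem_Ici]
  exact hfv₀.trans (le_sSup_closedBall hf w₀ R hv₀)

/-- `sup_{B̄(w, 1/(n+1))} f → f(w)` as `n → ∞` (upper semicontinuity at `w`). [folklore] -/
theorem tendsto_sSup_closedBall {f : X → ℝ} (hf : UpperSemicontinuous f) (w : X) :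
    Tendsto (fun n : ℕ => sSup (f '' closedBall w (1 / ((n : ℝ) + 1)))) atTop (𝓝 (f w)) := by
  rw [Metric.tendsto_atTop]
  intro ε hε
  have husc : ∀ᶠ v in 𝓝 w, f v < f w + ε / 2 := hf w (f w + ε / 2) (by linarith)
  obtain ⟨δ, hδ, hball⟩ := Metric.eventually_nhds_iff.1 husc
  obtain ⟨N, hN⟩ := exists_nat_gt (1 / δ)
  refine ⟨N, fun n hn => ?_⟩
  have hn' : 1 / ((n : ℝ) + 1) < δ := by
    have h1 : (1 / δ) < (n : ℝ) + 1 := lt_of_lt_of_le hN (by exact_mod_cast Nat.le_succ_of_le hn)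
    rw [div_lt_iff₀ hδ] at h1
    rw [div_lt_iff₀ (by positivity)]
    linarith
  have hlow : f w ≤ sSup (f '' closedBall w (1 / ((n : ℝ) + 1))) := le_sSup_closedBall hf w _ (mem_closedBall_self (by positivity))
  obtain ⟨v, hv, hveq⟩ := exists_eq_sSup_closedBall hf w (R := 1 / ((n : ℝ) + 1)) (by positivity)
  have hup : sSup (f '' closedBall w (1 / ((n : ℝ) + 1))) < f w + ε / 2 := by
    rw [← hveq]
    exact hball (lt_of_le_of_lt (mem_closedBall.1 hv) hn')
  rw [Real.dist_eq, abs_lt]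
  constructor <;> linarith

/-! ## §6. The Kantorovich side -/

omit [CompactSpace X] in
/-- `φ ⊕ ψ ≤ d²` ⇒ `φ(x)/2 ≤ Q₁(−ψ/2)(x) = inf_w [−ψ(w)/2 + d(x,w)²/2]`. [cite: BakryGentilLedoux2014, Thm 9.7.2] -/
theorem half_le_hopfLax_one {φ ψ : X → ℝ} (h : ∀ x y : X, φ x + ψ y ≤ dist x y ^ 2) (x : X) :
    φ x / 2 ≤ ⨅ w, (-(ψ w) / 2 + dist x w ^ 2 / (2 * 1)) := by
  haveI : Nonempty X := ⟨x⟩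
  refine le_ciInf fun w => ?_
  have := h x w
  linarith

omit [CompactSpace X] in
/-- **Lipschitz `c`-transform.**  For `φ ⊕ ψ ≤ d²` and `d ≤ Δ` on `X`, the function `ψ'(y) = inf_x [d(x,y)² − φ(x)]` dominates `ψ`, still satisfies
`φ ⊕ ψ' ≤ d²`, and is `2Δ`-Lipschitz and continuous. [cite: Villani2003, Thm. 1.3] -/
theorem exists_lipschitz_potential {φ ψ : X → ℝ} (h : ∀ x y : X, φ x + ψ y ≤ dist x y ^ 2)
    {Δ : ℝ} (hΔ : ∀ x y : X, dist x y ≤ Δ) :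
    ∃ ψ' : X → ℝ, (∀ y, ψ y ≤ ψ' y) ∧ (∀ x y, φ x + ψ' y ≤ dist x y ^ 2) ∧ (∀ y y', |ψ' y - ψ' y'| ≤ 2 * Δ * dist y y') ∧ Continuous ψ' := by
  have hne : ∀ y : X, Nonempty X := fun y => ⟨y⟩
  have hbdd : ∀ y : X, BddBelow (Set.range fun x => dist x y ^ 2 - φ x) := fun y =>
    ⟨ψ y, by rintro _ ⟨x, rfl⟩; have := h x y; show ψ y ≤ dist x y ^ 2 - φ x; linarith⟩
  have hΔ0 : ∀ y : X, 0 ≤ Δ := fun y => le_trans dist_nonneg (hΔ y y)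
  have hlip : ∀ y y' : X, |(⨅ x, (dist x y ^ 2 - φ x)) - (⨅ x, (dist x y' ^ 2 - φ x))| ≤ 2 * Δ * dist y y' := by
    have key : ∀ y y' : X, (⨅ x, (dist x y' ^ 2 - φ x)) ≤ (⨅ x, (dist x y ^ 2 - φ x)) + 2 * Δ * dist y y' := by
      intro y y'
      haveI := hne y
      rw [← sub_le_iff_le_add]
      refine le_ciInf fun x => ?_
      have h1 : (⨅ x, (dist x y' ^ 2 - φ x)) ≤ dist x y' ^ 2 - φ x := ciInf_le (hbdd y') x
      have h2 : dist x y' ≤ dist x y + dist y y' := dist_triangle x y y'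
      have h3 : dist x y' ^ 2 - dist x y ^ 2 ≤ 2 * Δ * dist y y' := by
        have hsum : dist x y' + dist x y ≤ 2 * Δ := by linarith [hΔ x y', hΔ x y]
        have : dist x y' ^ 2 - dist x y ^ 2 = (dist x y' + dist x y) * (dist x y' - dist x y) := by ring
        rw [this]
        calc (dist x y' + dist x y) * (dist x y' - dist x y) ≤ (dist x y' + dist x y) * dist y y' :=
              mul_le_mul_of_nonneg_left (by linarith) (by positivity)
          _ ≤ 2 * Δ * dist y y' := mul_le_mul_of_nonneg_right hsum dist_nonneg
      linarith
    intro y y'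
    rw [abs_le]; constructor
    · linarith [key y y']
    · have := key y' y; rw [dist_comm] at this; linarith
  refine ⟨fun y => ⨅ x, (dist x y ^ 2 - φ x), fun y => ?_, fun x y => ?_, hlip, ?_⟩
  · haveI := hne y
    exact le_ciInf fun x => by have := h x y; linarith
  · have h1 : (⨅ x, (dist x y ^ 2 - φ x)) ≤ dist x y ^ 2 - φ x := ciInf_le (hbdd y) x
    linarith
  · refine continuous_iff_continuousAt.2 fun y => ?_
    have hΔ0' : 0 ≤ Δ := hΔ0 y
    refine Metric.continuousAt_iff.2 fun ε hε => ⟨ε / (2 * Δ + 1), by positivity, fun y' hy' => ?_⟩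
    rw [Real.dist_eq]
    calc _ ≤ 2 * Δ * dist y' y := hlip y' y
      _ ≤ (2 * Δ + 1) * dist y' y := by nlinarith [dist_nonneg (x := y') (y := y)]
      _ < (2 * Δ + 1) * (ε / (2 * Δ + 1)) := mul_lt_mul_of_pos_left hy' (by positivity)
      _ = ε := by field_simp

end Summit.QuantumFields.YangMills.Theorems.ColdStartUniversality

end
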